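import Summits.HodgeConjecture.CorCM.GaloisClosureMeetsOneConjugateHodge
import Literature.NumberTheory.ComplexMultiplication.CommonAbelianCMSubfieldDegenerate
import Literature.AlgebraicGeometry.Pohlmann1968.SeparatingCMFamilies
import HarnessLib

/-!
# A CM abelian surface with CYCLIC quartic CM field times ANY CM abelian variety: the exact criterion
# "`K_S` does not embed in `K_A`", the Hodge conjecture on every `S^a × A^b`, and the exceptional classes otherwise

COR-CM (cell `pub-hodgecm2`, binder seat `b16` gen 40, count-neutral claim SxF-ONECONJ (F3)); NEW as stated, hence under
`Summits/`.  Theorems only; no definition, no named fact, no `sorry`.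

Let `S` be a CM abelian surface whose quartic CM field `K_S` is Galois with cyclic group (equivalently: a SIMPLE CM
abelian surface with Galois CM field, Shimura §8.4 (2)(A)/(B)), and `A` a realisation of an arbitrary CM type
`(K_A; Φ_A)` of an arbitrary CM field.  The tree decided the pair `S × A` when the Galois closure `L_A` does not contain
`K_S` (`SimpleCMSurfaceTimesCMHodge`, partial conjugations) and showed it DEGENERATE when `K_S ↪ K_A` (nested abelian CM
fields, `not_isNondegenerateFamily_of_ringHom_of_abelian`).  The gap `K_S ⊆ L_A`, `K_S ⊄ K_A` (e.g. `A` a simple CM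
fourfold whose octic field has Galois closure containing `K_S` without containing it itself) is closed by the
one-conjugate criterion (`GaloisClosureMeetsOneConjugateHodge`, this seat): `K_S ∩ y₀(K_A)` has degree `≤ 2` in the
cyclic quartic `K_S`, hence is totally real.  Result — the EXACT criterion, with no hypothesis on `L_A`:

* §1 **`isNondegenerateFamily_iff_of_cyclic_quartic`**: `(Φ_S, Φ_A)` is nondegenerate iff `Φ_A` is nondegenerate AND
  `K_S` does not embed in `K_A`; `cmFamilyRank_eq_of_cyclic_quartic_of_isEmpty` (`rank = rank(Φ_A) + 2`, i.e.
  `Hg(S × A) = Hg(S) × Hg(A)`); `isCyclic_of_isPrimitive_of_isGalois_quartic` (bookkeeping: a Galois quartic CM field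
  with a primitive type is cyclic).
* §2 geometry: **`hodgeConjectureFor_prod_cyclicSurface_times_of_isEmpty`** — the Hodge conjecture and `B• = D•` on
  EVERY `S^a × A^b` (every `⨁_{j<N} A_{π j}`) when `Φ_A` is nondegenerate and `K_S ⊄ K_A`, UNCONDITIONALLY;
  **`hodgeConjectureFor_prod_simpleGaloisSurface_times_of_isEmpty`** — the same stated for a SIMPLE surface with Galois
  quartic CM field; **`exists_exceptional_prod_cyclicSurface_times_of_ringHom`** — an embedding `K_S ↪ K_A` puts an
  exceptional Hodge class on some `S^a × A^b` (simple, non-isogenous realisations);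
  **`forall_prod_hodgeClassSpan_eq_iff_of_cyclic_quartic`** — for simple non-isogenous `S`, `A`: `B• = D•` on all
  `S^a × A^b` iff `Φ_A` is nondegenerate and `K_S ⊄ K_A`.
* §3 **`forall_prod_hodgeClassSpan_eq_iff_simpleSurface_fourfold`** — the case `A = F` a SIMPLE CM abelian FOURFOLD
  (`[K_F : ℚ] = 8`): `B• = D•` on all `S^a × F^b` iff `Φ_F` is nondegenerate and `K_S ⊄ K_F` — the cyclic half of the
  `(2, 4)` partition of dimension `6` (the non-Galois quartic half is type-dependent and not treated here).

## References

* [MoonenZarhin1999LowDim] B. Moonen, Yu. Zarhin, *Hodge classes on abelian varieties of low dimension*, Math. Ann.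
  315 (1999), Thm. (0.2) (the shape "`k ↪ End⁰(X₂)` or `B• = D•` on all powers" one dimension up).
* [Gordon1999HodgeAVSurvey] B. B. Gordon, *A survey of the Hodge conjecture for abelian varieties*, §3 Theorem, 7.5–7.7,
  10.10.
* [Shimura1998] G. Shimura, *Abelian Varieties with Complex Multiplication and Modular Functions*, §8.4 Example (2).
* [Kubota1965] T. Kubota, *On the field extension by complex multiplication*, §4 Lemma 2 (nested fields are degenerate).
-/

noncomputable section

open CategoryTheory CategoryTheory.Limits NumberField NumberField.ComplexEmbedding IntermediateField Module
open scoped BigOperators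

namespace Summit.HodgeConjecture.CorCM

open Literature.NumberTheory.ComplexMultiplication
open Literature.AlgebraicGeometry.Motives (AbelianVariety CMType)
open Literature.AlgebraicGeometry.HodgeTheory
open Literature.AlgebraicGeometry.ComplexMultiplication (IsCMTypeRealisation isSimple_iff_isPrimitive)
open Literature.AlgebraicGeometry.VanGeemen1994 (hodgeClassSpan)
open Literature.AlgebraicGeometry.Pohlmann1968
open Literature.Barriers.HodgeConjecture (divisorClassesSpan)

/-! ## §1 The exact criterion on types -/

section Types

variable {I : Type} {K : I → Type} [∀ i, Field (K i)] [∀ i, NumberField (K i)] [∀ i, IsCMField (K i)] [Fintype I]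
  [DecidableEq I]

omit [∀ i, IsCMField (K i)] [Fintype I] [DecidableEq I] in
/-- **A Galois quartic CM field carrying a primitive type is cyclic** (Shimura §8.4 (2)(A): in the biquadratic case no
type is primitive). [cite: Shimura1998, §8.4 Example (2)(A)] -/
theorem isCyclic_of_isPrimitive_of_isGalois_quartic (i : I) [IsGalois ℚ (K i)] (h4 : finrank ℚ (K i) = 4)
    {Φ : CMType (K i)} {φ₀ : K i →+* ℂ} (hprim : IsPrimitive (ℂ ≃+* ℂ) Φ.1 φ₀) : IsCyclic (K i ≃ₐ[ℚ] K i) := by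
  by_contra hG
  exact not_isPrimitive_of_not_isCyclic h4 hG Φ φ₀ hprim

omit [DecidableEq I] in
/-- `|I| = 2` for a two-slot index type. [folklore] -/
private theorem card_eq_two_of_pair {i₀ i₁ : I} (h01 : i₀ ≠ i₁) (hI : ∀ j, j = i₀ ∨ j = i₁) : Fintype.card I = 2 := by
  classical
  rw [← Finset.card_univ, show (Finset.univ : Finset I) = {i₀, i₁} from ?_, Finset.card_pair h01]
  ext j
  simp only [Finset.mem_univ, Finset.mem_insert, Finset.mem_singleton, true_iff]
  exact hI j

/-- **The exact criterion.**  `K_{i₀}` a cyclic quartic CM field, `K_{i₁}` any CM field, any types: the pair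
`(Φ_{i₀}, Φ_{i₁})` is nondegenerate iff `Φ_{i₁}` is nondegenerate AND `K_{i₀}` does not embed in `K_{i₁}`.
(⟸: the one-conjugate criterion, `K_{i₀} ∩ y₀(K_{i₁})` is `ℚ` or the real quadratic subfield; ⟹: nested abelian CM
fields are degenerate, Kubota.)  No hypothesis on the Galois closure of `K_{i₁}`.
[cite: Gordon1999HodgeAVSurvey, 7.5–7.7] [cite: Kubota1965, §4 Lemma 2] [cite: Shimura1998, §8.4 Example (2)(B)] -/
theorem isNondegenerateFamily_iff_of_cyclic_quartic {i₀ i₁ : I} (h01 : i₀ ≠ i₁) (hI : ∀ j, j = i₀ ∨ j = i₁)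
    (Φ : ∀ i, CMType (K i)) [IsGalois ℚ (K i₀)] [IsCyclic (K i₀ ≃ₐ[ℚ] K i₀)] (h4 : finrank ℚ (K i₀) = 4) :
    CMAlgebra.IsNondegenerateFamily Φ ↔ IsNondegenerate (Φ i₁) ∧ IsEmpty (K i₀ →+* K i₁) := by
  haveI : Nonempty I := ⟨i₀⟩
  refine ⟨fun hnd => ?_, fun ⟨h₁, he⟩ => (isNondegenerateFamily_iff_pair_of_cyclic_quartic_of_isEmpty h01 hI Φ h4 he).2 h₁⟩
  have h₁ : IsNondegenerate (Φ i₁) := hnd.isNondegenerate i₁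
  refine ⟨h₁, ?_⟩
  by_contra hne
  rw [not_isEmpty_iff] at hne
  obtain ⟨e⟩ := hne
  haveI : IsAbelianGalois ℚ (K i₀) := {}
  exact not_isNondegenerateFamily_of_ringHom_of_abelian h01 e Φ (isNondegenerate_of_isCyclic_of_finrank_eq_four h4 _)
    h₁ hnd

/-- **Nested case**: an embedding `K_{i₀} ↪ K_{i₁}` of the cyclic quartic CM field makes EVERY pair of types
degenerate (if `Φ_{i₁}` is degenerate the family is degenerate anyway). [cite: Kubota1965, §4 Lemma 2]
[cite: Gordon1999HodgeAVSurvey, 7.5–7.7] -/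
theorem not_isNondegenerateFamily_of_cyclic_quartic_of_ringHom {i₀ i₁ : I} (h01 : i₀ ≠ i₁)
    (hI : ∀ j, j = i₀ ∨ j = i₁) (Φ : ∀ i, CMType (K i)) [IsGalois ℚ (K i₀)] [IsCyclic (K i₀ ≃ₐ[ℚ] K i₀)]
    (h4 : finrank ℚ (K i₀) = 4) (e : K i₀ →+* K i₁) : ¬ CMAlgebra.IsNondegenerateFamily Φ := fun hnd =>
  ((isNondegenerateFamily_iff_of_cyclic_quartic h01 hI Φ h4).1 hnd).2.false e

/-- **Rank in the foreign case**: `rank(Φ_{i₀}, Φ_{i₁}) = rank(Φ_{i₁}) + 2` when `K_{i₀} ⊄ K_{i₁}` (`rank(Φ_{i₀}) = 3`;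
`Hg(S × A) = Hg(S) × Hg(A)`). [cite: Gordon1999HodgeAVSurvey, §3 Theorem (1) and 7.7] -/
theorem cmFamilyRank_eq_of_cyclic_quartic_of_isEmpty {i₀ i₁ : I} (h01 : i₀ ≠ i₁) (hI : ∀ j, j = i₀ ∨ j = i₁)
    (Φ : ∀ i, CMType (K i)) [IsGalois ℚ (K i₀)] [IsCyclic (K i₀ ≃ₐ[ℚ] K i₀)] (h4 : finrank ℚ (K i₀) = 4)
    (he : IsEmpty (K i₀ →+* K i₁)) : CMAlgebra.cmFamilyRank Φ = cmTypeRank (Φ i₁) + 2 := by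
  classical
  obtain ⟨y₀⟩ : Nonempty (K i₁ →+* ℂ) := inferInstance
  have h := cmFamilyRank_add_card_eq_pair_of_oneConjugate h01 hI Φ y₀
    fun _ hx hx' => conj_apply_eq_of_cyclic_quartic_of_isEmpty h4 he y₀ hx hx'
  have h3 : cmTypeRank (Φ i₀) = 3 := by
    have := (isNondegenerate_iff (Φ i₀)).1 (isNondegenerate_of_isCyclic_of_finrank_eq_four h4 (Φ i₀))
    rw [this, h4]
  rw [card_eq_two_of_pair h01 hI, show (Finset.univ : Finset I) = {i₀, i₁} from ?_, Finset.sum_pair h01, h3] at h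
  · omega
  · ext j
    simp only [Finset.mem_univ, Finset.mem_insert, Finset.mem_singleton, true_iff]
    exact hI j

end Types

/-! ## §2 Geometry: every `S^a × A^b` -/

section Geometry

variable {I : Type} {K : I → Type} [∀ i, Field (K i)] [∀ i, NumberField (K i)] [∀ i, IsCMField (K i)] [Fintype I]
  [DecidableEq I] {Φ : ∀ i, CMType (K i)}
variable {A : I → AbelianVariety ℂ} {ι : ∀ i, 𝓞 (K i) →+* End (A i)}
  {θ : ∀ i, K i →+* Module.End ℂ (complexBetti (A i).X 1)}

/-- **A CM abelian surface `S` with cyclic quartic CM field `K_S ⊄ K_A` times a realisation `A` of a nondegenerate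
type `(K_A; Φ_A)`: the Hodge conjecture and `B• = D•` on EVERY `S^a × A^b`** (every `⨁_{j<N} A_{π j}`),
UNCONDITIONALLY — whatever the Galois closure of `K_A`. [cite: Gordon1999HodgeAVSurvey, §3 Theorem, 7.5 and 10.10]
[cite: Shimura1998, §8.4 Example (2)(B)] -/
theorem hodgeConjectureFor_prod_cyclicSurface_times_of_isEmpty {i₀ i₁ : I} (h01 : i₀ ≠ i₁)
    (hI : ∀ j, j = i₀ ∨ j = i₁) [IsGalois ℚ (K i₀)] [IsCyclic (K i₀ ≃ₐ[ℚ] K i₀)] (h4 : finrank ℚ (K i₀) = 4)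
    (he : IsEmpty (K i₀ →+* K i₁)) (hΦ₁ : IsNondegenerate (Φ i₁))
    (hA : ∀ i, IsCMTypeRealisation (Φ i) (A i) (ι i) (θ i)) {N : ℕ} (π : Fin N → I) :
    HodgeConjectureFor (⨁ fun j : Fin N => A (π j)).dim (⨁ fun j : Fin N => A (π j)).X ∧
      ∀ m : ℕ, hodgeClassSpan (⨁ fun j : Fin N => A (π j)).dim (⨁ fun j : Fin N => A (π j)).X m =
        divisorClassesSpan (⨁ fun j : Fin N => A (π j)).X (⨁ fun j : Fin N => A (π j)).dim m :=
  haveI : Nonempty I := ⟨i₀⟩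
  have hnd := (isNondegenerateFamily_iff_of_cyclic_quartic h01 hI Φ h4).2 ⟨hΦ₁, he⟩
  ⟨hnd.hodgeConjectureFor_prod hA π, fun m => hnd.hodgeClassSpan_prod_eq_divisorClassesSpan hA π m⟩

/-- **A SIMPLE CM abelian surface `S` with GALOIS quartic CM field `K_S ⊄ K_A` times a realisation `A` of a
nondegenerate CM type: the Hodge conjecture and `B• = D•` on every `S^a × A^b`** (simplicity of `S` makes `K_S` cyclic).
[cite: Shimura1998, §8.4 Example (2)(A)/(B)] [cite: Gordon1999HodgeAVSurvey, §3 Theorem, 7.5 and 10.10] -/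
theorem hodgeConjectureFor_prod_simpleGaloisSurface_times_of_isEmpty {i₀ i₁ : I} (h01 : i₀ ≠ i₁)
    (hI : ∀ j, j = i₀ ∨ j = i₁) [IsGalois ℚ (K i₀)] (h4 : finrank ℚ (K i₀) = 4) (he : IsEmpty (K i₀ →+* K i₁))
    (hΦ₁ : IsNondegenerate (Φ i₁)) (hA : ∀ i, IsCMTypeRealisation (Φ i) (A i) (ι i) (θ i))
    (hS : (A i₀).IsSimple) {N : ℕ} (π : Fin N → I) :
    HodgeConjectureFor (⨁ fun j : Fin N => A (π j)).dim (⨁ fun j : Fin N => A (π j)).X ∧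
      ∀ m : ℕ, hodgeClassSpan (⨁ fun j : Fin N => A (π j)).dim (⨁ fun j : Fin N => A (π j)).X m =
        divisorClassesSpan (⨁ fun j : Fin N => A (π j)).X (⨁ fun j : Fin N => A (π j)).dim m := by
  obtain ⟨φ₀⟩ : Nonempty (K i₀ →+* ℂ) := inferInstance
  haveI : IsCyclic (K i₀ ≃ₐ[ℚ] K i₀) :=
    isCyclic_of_isPrimitive_of_isGalois_quartic i₀ h4 ((isSimple_iff_isPrimitive (hA i₀) φ₀).1 hS)
  exact hodgeConjectureFor_prod_cyclicSurface_times_of_isEmpty h01 hI h4 he hΦ₁ hA π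

/-- **An embedding `K_S ↪ K_A` forces an exceptional Hodge class on some `S^a × A^b`** (`S`, `A` simple, non-isogenous
realisations; `K_S` cyclic quartic): a rational `(m,m)` class outside `Dᵐ ⊗ ℂ` on some `⨁_{j<N} A_{π j}` — Kubota's
nested fields, read on the varieties. [cite: Kubota1965, §4 Lemma 2] [cite: Gordon1999HodgeAVSurvey, 7.5]
[cite: Milne1999LefschetzClasses, Prop. 4.8] -/
theorem exists_exceptional_prod_cyclicSurface_times_of_ringHom {i₀ i₁ : I} (h01 : i₀ ≠ i₁)
    (hI : ∀ j, j = i₀ ∨ j = i₁) [IsGalois ℚ (K i₀)] [IsCyclic (K i₀ ≃ₐ[ℚ] K i₀)] (h4 : finrank ℚ (K i₀) = 4)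
    (e : K i₀ →+* K i₁) (hA : ∀ i, IsCMTypeRealisation (Φ i) (A i) (ι i) (θ i)) (hs : ∀ i, (A i).IsSimple)
    (hniso : ∀ i j, i ≠ j → ¬ AbelianVariety.IsIsogenous (A i) (A j)) :
    ∃ (N : ℕ) (π : Fin N → I) (m : ℕ) (c : complexBetti (⨁ fun j : Fin N => A (π j)).X (2 * m)),
      IsRationalClass c ∧
      IsOfHodgeType (⨁ fun j : Fin N => A (π j)).dim (⨁ fun j : Fin N => A (π j)).X (2 * m) m m c ∧
      c ∉ divisorClassesSpan (⨁ fun j : Fin N => A (π j)).X (⨁ fun j : Fin N => A (π j)).dim m :=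
  haveI : Nonempty I := ⟨i₀⟩
  CMAlgebra.exists_exceptional_prod_of_not_isNondegenerateFamily
    (CMAlgebra.isSeparatingFamily_of_isSimple_of_pairwise_not_isIsogenous hA hs hniso)
    (not_isNondegenerateFamily_of_cyclic_quartic_of_ringHom h01 hI Φ h4 e) hA

/-- **The dichotomy on the varieties** (`S`, `A` simple, non-isogenous realisations; `K_S` cyclic quartic): `B• = D•` on
ALL `S^a × A^b` iff `Φ_A` is nondegenerate and `K_S` does not embed in `K_A` — Moonen–Zarhin's "(a) or (4)" shape one
dimension up. [cite: MoonenZarhin1999LowDim, Thm. (0.2)] [cite: Gordon1999HodgeAVSurvey, 7.5] -/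
theorem forall_prod_hodgeClassSpan_eq_iff_of_cyclic_quartic {i₀ i₁ : I} (h01 : i₀ ≠ i₁)
    (hI : ∀ j, j = i₀ ∨ j = i₁) [IsGalois ℚ (K i₀)] [IsCyclic (K i₀ ≃ₐ[ℚ] K i₀)] (h4 : finrank ℚ (K i₀) = 4)
    (hA : ∀ i, IsCMTypeRealisation (Φ i) (A i) (ι i) (θ i)) (hs : ∀ i, (A i).IsSimple)
    (hniso : ∀ i j, i ≠ j → ¬ AbelianVariety.IsIsogenous (A i) (A j)) :
    (∀ (N : ℕ) (π : Fin N → I) (m : ℕ),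
      hodgeClassSpan (⨁ fun j : Fin N => A (π j)).dim (⨁ fun j : Fin N => A (π j)).X m =
        divisorClassesSpan (⨁ fun j : Fin N => A (π j)).X (⨁ fun j : Fin N => A (π j)).dim m) ↔
      IsNondegenerate (Φ i₁) ∧ IsEmpty (K i₀ →+* K i₁) := by
  haveI : Nonempty I := ⟨i₀⟩
  rw [← CMAlgebra.isNondegenerateFamily_iff_forall_prod_hodgeClassSpan_eq
    (CMAlgebra.isSeparatingFamily_of_isSimple_of_pairwise_not_isIsogenous hA hs hniso) hA]
  exact isNondegenerateFamily_iff_of_cyclic_quartic h01 hI Φ h4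

end Geometry

/-! ## §3 A simple CM surface with Galois CM field times a simple CM fourfold -/

section SurfaceFourfold

variable {I : Type} {K : I → Type} [∀ i, Field (K i)] [∀ i, NumberField (K i)] [∀ i, IsCMField (K i)] [Fintype I]
  [DecidableEq I] {Φ : ∀ i, CMType (K i)}
variable {A : I → AbelianVariety ℂ} {ι : ∀ i, 𝓞 (K i) →+* End (A i)}
  {θ : ∀ i, K i →+* Module.End ℂ (complexBetti (A i).X 1)}

omit [∀ i, IsCMField (K i)] [Fintype I] [DecidableEq I] in
/-- Two number fields of different degrees are not isomorphic. [folklore] -/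
private theorem finrank_eq_of_ringEquiv {i j : I} (e : K i ≃+* K j) : finrank ℚ (K i) = finrank ℚ (K j) :=
  (AlgEquiv.ofRingEquiv (f := e) fun q => by rw [eq_ratCast]; exact map_ratCast e q).toLinearEquiv.finrank_eq

omit [∀ i, IsCMField (K i)] [Fintype I] [DecidableEq I] in
/-- Simple realisations with CM fields of pairwise different degrees carry a separating family (primitive members, and no
field isomorphism between different slots). [cite: Gordon1999HodgeAVSurvey, 7.4] [cite: Shimura1998, §8.2 Prop. 26] -/
theorem isSeparatingFamily_of_isSimple_of_finrank_injective (hA : ∀ i, IsCMTypeRealisation (Φ i) (A i) (ι i) (θ i))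
    (hs : ∀ i, (A i).IsSimple) (hdeg : ∀ i j, finrank ℚ (K i) = finrank ℚ (K j) → i = j) :
    CMAlgebra.IsSeparatingFamily Φ :=
  CMAlgebra.isSeparatingFamily_of_isPrimitive (fun i s₀ => (isSimple_iff_isPrimitive (hA i) s₀).1 (hs i))
    fun i j e _ => hdeg i j (finrank_eq_of_ringEquiv e)

/-- **`S × F`, `S` a simple CM abelian surface with GALOIS (hence cyclic) quartic CM field `K_S`, `F` a simple CM
abelian fourfold with octic CM field `K_F` and type `Φ_F`: `B• = D•` on ALL `S^a × F^b` iff `Φ_F` is nondegenerate and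
`K_S` does not embed in `K_F`** — and then the Hodge conjecture holds on every `S^a × F^b`
(`hodgeConjectureFor_prod_simpleGaloisSurface_times_of_isEmpty`); otherwise some `S^a × F^b` carries an exceptional
Hodge class.  The cyclic half of the `(2, 4)` partition of dimension `6`; no hypothesis on the Galois closure of `K_F`.
[cite: MoonenZarhin1999LowDim, Thm. (0.2)] [cite: Gordon1999HodgeAVSurvey, 7.5 and 10.10] [cite: Shimura1998, §8.4 Example (2)] -/
theorem forall_prod_hodgeClassSpan_eq_iff_simpleSurface_fourfold {i₀ i₁ : I} (h01 : i₀ ≠ i₁)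
    (hI : ∀ j, j = i₀ ∨ j = i₁) [IsGalois ℚ (K i₀)] (h4 : finrank ℚ (K i₀) = 4) (h8 : finrank ℚ (K i₁) = 8)
    (hA : ∀ i, IsCMTypeRealisation (Φ i) (A i) (ι i) (θ i)) (hs : ∀ i, (A i).IsSimple) :
    (∀ (N : ℕ) (π : Fin N → I) (m : ℕ),
      hodgeClassSpan (⨁ fun j : Fin N => A (π j)).dim (⨁ fun j : Fin N => A (π j)).X m =
        divisorClassesSpan (⨁ fun j : Fin N => A (π j)).X (⨁ fun j : Fin N => A (π j)).dim m) ↔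
      IsNondegenerate (Φ i₁) ∧ IsEmpty (K i₀ →+* K i₁) := by
  haveI : Nonempty I := ⟨i₀⟩
  obtain ⟨φ₀⟩ : Nonempty (K i₀ →+* ℂ) := inferInstance
  haveI : IsCyclic (K i₀ ≃ₐ[ℚ] K i₀) :=
    isCyclic_of_isPrimitive_of_isGalois_quartic i₀ h4 ((isSimple_iff_isPrimitive (hA i₀) φ₀).1 (hs i₀))
  have hsep : CMAlgebra.IsSeparatingFamily Φ := by
    refine isSeparatingFamily_of_isSimple_of_finrank_injective hA hs fun i j hij => ?_
    rcases hI i with rfl | rfl <;> rcases hI j with rfl | rfl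
    · rfl
    · rw [h4, h8] at hij; omega
    · rw [h4, h8] at hij; omega
    · rfl
  rw [← CMAlgebra.isNondegenerateFamily_iff_forall_prod_hodgeClassSpan_eq hsep hA]
  exact isNondegenerateFamily_iff_of_cyclic_quartic h01 hI Φ h4

/-- **`S × F` with `K_S ⊄ K_F` and `Φ_F` nondegenerate: the Hodge conjecture on every `S^a × F^b`** (`S` simple with
Galois quartic CM field, `F` a simple CM fourfold) — recorded in the dimension-`6` vocabulary.
[cite: Gordon1999HodgeAVSurvey, 7.5 and 10.10] [cite: Shimura1998, §8.4 Example (2)] -/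
theorem hodgeConjectureFor_prod_simpleSurface_fourfold_of_isEmpty {i₀ i₁ : I} (h01 : i₀ ≠ i₁)
    (hI : ∀ j, j = i₀ ∨ j = i₁) [IsGalois ℚ (K i₀)] (h4 : finrank ℚ (K i₀) = 4)
    (he : IsEmpty (K i₀ →+* K i₁)) (hΦ₁ : IsNondegenerate (Φ i₁))
    (hA : ∀ i, IsCMTypeRealisation (Φ i) (A i) (ι i) (θ i)) (hS : (A i₀).IsSimple) {N : ℕ} (π : Fin N → I) :
    HodgeConjectureFor (⨁ fun j : Fin N => A (π j)).dim (⨁ fun j : Fin N => A (π j)).X :=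
  (hodgeConjectureFor_prod_simpleGaloisSurface_times_of_isEmpty h01 hI h4 he hΦ₁ hA hS π).1

end SurfaceFourfold

end Summit.HodgeConjecture.CorCM

end
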